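import Summits.SmoothPoincare4.SmoothPoincare4.Theses.InformationMetricHadamard
import Literature.Geometry.Manifold.MaximalIntegralCurve

/-!
# Stub `stub_flowToRoundSphere` of line `core-distance-morse` — auxiliary file 2: flow lines in
# the radial zone (crux `InformationMetricHadamard.C0AhRecognition`, stmt-SmoothPoincare4-6015)

Let `e : ℝ⁵ ≅ W` be a diffeomorphism, `|v|ₒ := √(G_o(v, v))` a Euclidean-type gauge on `ℝ⁵`
(`G_o` bilinear), and `X` a `C¹` vector field on `W` which is **radial** outside the gauge ball of
radius `R₀`: `X (e v) = de_v (v / |v|ₒ)` for `|v|ₒ ≥ R₀`. Then for `|v|ₒ > R₀` the curve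
`t ↦ e ((1 + t/|v|ₒ) v)` is an integral curve of `X` for `t > R₀ - |v|ₒ` (chain rule, and
`|(1 + t/|v|ₒ) v|ₒ = |v|ₒ + t`), so by uniqueness of integral curves every family of integral
curves `θ` of `X` with `θ (0, p) = p` satisfies `θ (t, e v) = e ((1 + t/|v|ₒ) v)` for `t ≥ 0`:
flow lines entering the radial zone are rays, traversed at unit gauge speed.

* `FlowToRoundSphere.sqrt_val_smul` — `|σ v|ₒ = σ |v|ₒ` for `σ ≥ 0`;
* `FlowToRoundSphere.hasMFDerivAt_radialCurve` — the rays are integral curves of `X`;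
* `helper_flowToRoundSphere_2` — the registered helper (the formula for `θ (t, e v)`).

Everything is proved (kind = proof); no definitions.
-/

noncomputable section

-- the prescribed namespace `Summit.<P>.<Sub>.…` duplicates `SmoothPoincare4` (P = Sub)
set_option linter.dupNamespace false

open scoped Manifold ContDiff Topology
open Set Function Bundle Filter Manifold

namespace Summit.SmoothPoincare4.SmoothPoincare4.Cruxes.C0AhRecognition.CoreDistanceMorse

open Literature.Geometry.Lorentzian Literature.Geometry.Lorentzian.PseudoRiemannianMetric
  Literature.Geometry.Manifold

namespace FlowToRoundSphere

/-- **Gauge of a dilate**: `√(B(σ v, σ v)) = σ √(B(v, v))` for a bilinear form `B` and `σ ≥ 0`.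
[folklore] -/
theorem sqrt_val_smul {E : Type*} [NormedAddCommGroup E] [NormedSpace ℝ E]
    (B : E →L[ℝ] E →L[ℝ] ℝ) (v : E) {σ : ℝ} (hσ : 0 ≤ σ) :
    Real.sqrt (B (σ • v) (σ • v)) = σ * Real.sqrt (B v v) := by
  have h : B (σ • v) (σ • v) = σ * σ * B v v := by
    simp only [map_smul, FunLike.coe_smul, Pi.smul_apply, smul_eq_mul]
    ring
  rw [h, Real.sqrt_mul (mul_self_nonneg σ), Real.sqrt_mul_self hσ]

variable {W : Type} [TopologicalSpace W] [ChartedSpace (EuclideanSpace ℝ (Fin 5)) W]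

/-- **Rays are integral curves of a radial field.** If `X (e v) = de_v (v/|v|ₒ)` whenever
`|v|ₒ ≥ R₀` (`|v|ₒ = √(B(v,v))`, `e : ℝ⁵ ≅ W`), then for `|v|ₒ > 0` the ray
`c(s) = e ((1 + s/|v|ₒ) v)` satisfies `c'(s) = X (c s)` for every `s > R₀ - |v|ₒ`
(chain rule; the point `(1 + s/|v|ₒ) v` has gauge `|v|ₒ + s ≥ R₀` and unit radial vector
`v/|v|ₒ`). [folklore] -/
theorem hasMFDerivAt_radialCurve [IsManifold (𝓡 5) ∞ W]
    (B : EuclideanSpace ℝ (Fin 5) →L[ℝ] EuclideanSpace ℝ (Fin 5) →L[ℝ] ℝ)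
    {X : Π y : W, TangentSpace (𝓡 5) y} {R₀ : ℝ} (hR₀ : 0 ≤ R₀)
    (e : EuclideanSpace ℝ (Fin 5) ≃ₘ^∞⟮𝓡 5, 𝓡 5⟯ W)
    (hrad : ∀ v : EuclideanSpace ℝ (Fin 5), R₀ ≤ Real.sqrt (B v v) →
      X (e v) = mfderiv (𝓡 5) (𝓡 5) e v ((Real.sqrt (B v v))⁻¹ • v))
    {v : EuclideanSpace ℝ (Fin 5)} (hv : 0 < Real.sqrt (B v v)) {s : ℝ}
    (hs : R₀ - Real.sqrt (B v v) < s) :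
    HasMFDerivAt 𝓘(ℝ, ℝ) (𝓡 5) (fun s : ℝ ↦ e ((1 + s / Real.sqrt (B v v)) • v)) s
      ((1 : ℝ →L[ℝ] ℝ).smulRight
        (X (e ((1 + s / Real.sqrt (B v v)) • v)))) := by
  set nv : ℝ := Real.sqrt (B v v) with hnv
  have hnv0 : nv ≠ 0 := hv.ne'
  -- the dilation factor is positive and the dilate lies in the radial zone
  have hσ : 1 + s / nv = (nv + s) / nv := by field_simp
  have hσ0 : 0 < 1 + s / nv := by
    rw [hσ]
    exact div_pos (by linarith) hv
  have hgauge : Real.sqrt (B ((1 + s / nv) • v) ((1 + s / nv) • v)) = (1 + s / nv) * nv :=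
    sqrt_val_smul B v hσ0.le
  have hzone : R₀ ≤ Real.sqrt (B ((1 + s / nv) • v) ((1 + s / nv) • v)) := by
    rw [hgauge, hσ, div_mul_cancel₀ _ hnv0]
    linarith
  have hX := hrad ((1 + s / nv) • v) hzone
  rw [hgauge, smul_smul, show ((1 + s / nv) * nv)⁻¹ * (1 + s / nv) = 1 / nv by
    rw [mul_inv, mul_assoc, mul_comm nv⁻¹, ← mul_assoc, inv_mul_cancel₀ hσ0.ne', one_mul,
      one_div]] at hX
  -- chain rule
  have hg : HasMFDerivAt 𝓘(ℝ, ℝ) 𝓘(ℝ, EuclideanSpace ℝ (Fin 5)) (fun s : ℝ ↦ (1 + s / nv) • v) s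
      ((1 : ℝ →L[ℝ] ℝ).smulRight ((1 / nv) • v)) :=
    hasMFDerivAt_iff_hasFDerivAt.mpr
      ((((hasDerivAt_id s).div_const nv).const_add 1).smul_const v).hasFDerivAt
  have he : HasMFDerivAt 𝓘(ℝ, EuclideanSpace ℝ (Fin 5)) (𝓡 5) e ((1 + s / nv) • v)
      (mfderiv 𝓘(ℝ, EuclideanSpace ℝ (Fin 5)) (𝓡 5) e ((1 + s / nv) • v)) :=
    (e.contMDiff.mdifferentiableAt (by simp)).hasMFDerivAt
  refine ((HasMFDerivAt.comp s he hg).congr_mfderiv (ContinuousLinearMap.ext_ring ?_) :)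
  show mfderiv 𝓘(ℝ, EuclideanSpace ℝ (Fin 5)) (𝓡 5) e ((1 + s / nv) • v)
      ((1 : ℝ) • ((1 / nv) • v)) = (1 : ℝ) • X (e ((1 + s / nv) • v))
  rw [one_smul, one_smul, hX]

/-- **Uniqueness: flow lines in the radial zone are rays.** With `e, B = G_o, X, R₀` as in
`hasMFDerivAt_radialCurve` (`X` of class `C¹`) and any family `θ` of integral curves of `X`
with `θ (0, p) = p`: for `|v|ₒ > R₀`, `R₀ ≥ 0`, and `t ≥ 0`,
`θ (t, e v) = e ((1 + t/|v|ₒ) v)` (both sides are integral curves on the interval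
`(R₀ - |v|ₒ, ∞) ∋ 0` through `e v`). [cite: LeeSmoothManifolds2013, Thm. 9.12 (a)] -/
theorem flow_eq_radial [T2Space W] [IsManifold (𝓡 5) ∞ W]
    (B : EuclideanSpace ℝ (Fin 5) →L[ℝ] EuclideanSpace ℝ (Fin 5) →L[ℝ] ℝ)
    {X : Π y : W, TangentSpace (𝓡 5) y} {R₀ : ℝ} (hR₀ : 0 ≤ R₀)
    (e : EuclideanSpace ℝ (Fin 5) ≃ₘ^∞⟮𝓡 5, 𝓡 5⟯ W)
    (hX : ContMDiff (𝓡 5) (𝓡 5).tangent 1 (fun y ↦ (⟨y, X y⟩ : TangentBundle (𝓡 5) W)))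
    (hrad : ∀ v : EuclideanSpace ℝ (Fin 5), R₀ ≤ Real.sqrt (B v v) →
      X (e v) = mfderiv (𝓡 5) (𝓡 5) e v ((Real.sqrt (B v v))⁻¹ • v))
    {θ : ℝ × W → W} (h0 : ∀ p : W, θ (0, p) = p)
    (hcurve : ∀ p : W, IsMIntegralCurve (fun t : ℝ ↦ θ (t, p)) X)
    {v : EuclideanSpace ℝ (Fin 5)} (hv : R₀ < Real.sqrt (B v v)) {t : ℝ} (ht : 0 ≤ t) :
    θ (t, e v) = e ((1 + t / Real.sqrt (B v v)) • v) := by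
  have hv0 : 0 < Real.sqrt (B v v) := hR₀.trans_lt hv
  have hJ : (0 : ℝ) ∈ Ioi (R₀ - Real.sqrt (B v v)) := by
    show R₀ - Real.sqrt (B v v) < 0
    linarith
  have hc : IsMIntegralCurveOn (fun s : ℝ ↦ e ((1 + s / Real.sqrt (B v v)) • v)) X
      (Ioi (R₀ - Real.sqrt (B v v))) := fun s hs ↦
    (hasMFDerivAt_radialCurve B hR₀ e hrad hv0 hs).hasMFDerivWithinAt
  have h := eqOn_of_isMIntegralCurveOn hX isOpen_Ioi ordConnected_Ioi hJ
    ((hcurve (e v)).isMIntegralCurveOn _) hc (by simp [h0])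
  exact h (show R₀ - Real.sqrt (B v v) < t by linarith)

end FlowToRoundSphere

open FlowToRoundSphere in
/-- **Helper 2 for stub E3 (`flowToRoundSphere`): flow lines in the radial zone are rays.** For a
diffeomorphism `e : ℝ⁵ ≅ W`, the gauge `|v|ₒ = √(G_o(v,v))`, a `C^∞` field `X` on `W` with
`X (e v) = de_v (v/|v|ₒ)` for `|v|ₒ ≥ R₀ > 0`, and any family `θ` of integral curves of `X` with
`θ (0, p) = p`: `θ (t, e v) = e ((1 + t/|v|ₒ) v)` for `|v|ₒ > R₀` and `t ≥ 0`.
[cite: LeeSmoothManifolds2013, Thm. 9.12 (a)] -/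
theorem helper_flowToRoundSphere_2
    (W : Type) [TopologicalSpace W] [T2Space W]
    [ChartedSpace (EuclideanSpace ℝ (Fin 5)) W] [IsManifold (𝓡 5) ∞ W]
    (G : PseudoRiemannianMetric (𝓡 5) ∞ (EuclideanSpace ℝ (Fin 5)) (TangentSpace (𝓡 5) : W → Type _))
    (X : Π y : W, TangentSpace (𝓡 5) y) (o : W) (R₀ : ℝ)
    (e : EuclideanSpace ℝ (Fin 5) ≃ₘ^∞⟮𝓡 5, 𝓡 5⟯ W) (hR₀ : 0 < R₀)
    (hX : ContMDiff (𝓡 5) (𝓡 5).tangent ∞ (fun y ↦ (⟨y, X y⟩ : TangentBundle (𝓡 5) W)))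
    (hrad : ∀ v : EuclideanSpace ℝ (Fin 5), R₀ ≤ Real.sqrt (G.val o v v) →
      X (e v) = mfderiv (𝓡 5) (𝓡 5) e v ((Real.sqrt (G.val o v v))⁻¹ • v))
    (θ : ℝ × W → W) (h0 : ∀ p : W, θ (0, p) = p)
    (hcurve : ∀ p : W, IsMIntegralCurve (fun t : ℝ ↦ θ (t, p)) X)
    (v : EuclideanSpace ℝ (Fin 5)) (hv : R₀ < Real.sqrt (G.val o v v)) (t : ℝ) (ht : 0 ≤ t) :
    θ (t, e v) = e ((1 + t / Real.sqrt (G.val o v v)) • v) :=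
  flow_eq_radial (G.val o) hR₀.le e (hX.of_le (by exact_mod_cast le_top)) hrad h0 hcurve hv ht


end Summit.SmoothPoincare4.SmoothPoincare4.Cruxes.C0AhRecognition.CoreDistanceMorse

end
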